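import Literature.AlgebraicGeometry.Frobenioids.ArchimedeanStandardType
import Literature.AlgebraicGeometry.Frobenioids.ArchimedeanTheoremsInstances
import Literature.AlgebraicGeometry.Frobenioids.ArchimedeanFrobeniusIsotropic
import Literature.AlgebraicGeometry.Frobenioids.ArchimedeanAngloidCoAngular
import Literature.AlgebraicGeometry.Frobenioids.ArchimedeanIsotropy
import Literature.AlgebraicGeometry.Frobenioids.DivisorMonoidBirationalStandardProofs
import HarnessLib

/-!
# Frobenioids II, Theorem 3.6 (i)/(ii): the STANDARD-TYPE clauses — what the tree closes now
# (abc-iut cell, layer L1, node `FrdII:Thm3.6(i)`/`(ii)`, L1-lead row M16; proof-only companion of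
# `ArchimedeanStandardType.lean`, seat abc-iut-L1-t9)

Mochizuki, *The geometry of Frobenioids II: poly-Frobenioids*, Kyushu J. Math. **62** (2008)
401–460, §3, Theorem 3.6 (i) (last clause) and (ii) (last clause), author's text p. 36 (last lines) and
p. 37 ll. 3–5; proof p. 38 ll. 14–40 [cite: MochizukiFrdII2008, Thm 3.6 pp.36-38]:

> (ii) "… If, moreover, `D` is of FSMFF- and RC-iso-subanchor type, then `A` is of standard [but not
> of rationally standard] type."  Proof (p. 38): "If, moreover, `D` is of FSMFF- and RC-iso-subanchor
> type [which implies, in particular, that `D` admits complex objects], then one verifies immediately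
> that the complex isotropic objects of `A` are Frobenius-compact; moreover, the quasi-isotropicity of
> `A` follows from Proposition 3.5, (ii), while the Frobenius-isotropicity, and Frobenius-normalizedness
> of `A` follows immediately from the corresponding properties for `C` …; thus, we conclude that `A` is
> of standard type. On the other hand, since, as is easily verified, `(A^un-tr)^birat` is of unit-trivial
> type, it follows that `A` is not of rationally standard type."

"Standard type" is [FrdI] Def. 3.1 (i), typed as `PreFrobenioidData.IsOfStandardType` (six fields
(a) quasi-isotropic, (a) Frobenius-isotropic, (b) a Frobenius-compact isotropic object if group-like,
(c) Frobenius-normalized, (d) base of FSMFF-type, (e) non-dilating divisor monoid); "rationally standard"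
is [FrdI] Def. 4.5 (iii), `PreFrobenioidData.IsOfRationallyStandardType S R` over the parameter bundle
`R : RSParams` (birationalization / support / unit-trivialisation data).  We read the structures of
Example 3.3 through the adapter `PreFrobenioidData.ofFunctor`: `S_C = ofFunctor (Φ π) (C.toElem π)` and
`S_A = ofFunctor 0_D (A.toElem π)`.

PROVED here (nothing defined):
* (e) for `C` and `A`: `C.isNonDilatingOn`, `A.isNonDilatingOn` ("[since `Φ` is manifestly
  non-dilating]", p. 38 l. 29; for `A` the divisor monoid is `0`);
* (c) for `C` and `A`: `C.isOfFrobeniusNormalizedType`, `A.isOfFrobeniusNormalizedType` — a base-identity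
  endomorphism `φ = (id, d, c)` and `α = (id, 1, a) ∈ O^▷` satisfy `α^d ∘ φ = φ ∘ α` (both have scalar
  `c · a^d`);
* (a, Frobenius-isotropic) for `C` and `A`: `C.isOfFrobeniusIsotropicType` (Ex. 3.3 (ii), PROVED in
  `ArchimedeanFrobeniusIsotropic.lean`, read through the adapter) and `A.isOfFrobeniusIsotropicType`
  ("follows immediately from the corresponding property for `C`": the Frobenius-type arrow of `C` is an
  isometry, co-angular in `A` iff in `C` — `Ex33iii_coAngular_iff_holds` — with isotropic codomain in `A`
  iff in `C` — `Ex33iii_isotropic_iff_holds`);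
* (b) for `C`: `C` is not of group-like type as soon as `D` has an object (`C.not_isOfGroupLikeType`);
* the ASSEMBLIES: `A.isOfStandardType_of` — `A` is of standard type GIVEN Prop. 3.5 (ii) for `A` (named
  input `ArchFrd.Prop35ii_A π`, node `FrdII:Prop3.5(ii)`, open) and ONE isotropic Frobenius-compact
  object of `A` (the printed "complex isotropic objects of `A` are Frobenius-compact", which needs a
  complex object of `D`: separate piece), over a base of FSMFF- and RC-iso-subanchor type; and
  `C.isOfStandardType_of` — `C` is of standard type GIVEN Prop. 3.5 (ii) for `C` and an object of `D`;
* the negative half of (ii) in generic form: a Frobenioid NONE of whose `(C^un-tr)^birat`-objects has a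
  non-torsion unit — in particular one whose `(C^un-tr)^birat` is of unit-trivial type — is not of
  rationally standard type (`PreFrobenioidData.not_isOfRationallyStandardType_of_forall_isUnitTrivial`;
  the printed reason "`(A^un-tr)^birat` is of unit-trivial type" is a statement about THE
  unit-trivialisation/birationalization data, to be supplied at the closed instance).
Not done here (census M16, INBOX 2026-08-25T23:54Z): Prop. 3.5 (ii) itself; the Frobenius-compactness
of complex isotropic objects of `A`; the `RSParams`-bound clauses of (i) ("rationally standard" for
`C^Λ`). No statement of the paper is strengthened; no side is taken on [IUTchIII] Cor. 3.12.
-/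

namespace Literature.AlgebraicGeometry.Frobenioids

open CategoryTheory

universe w vb v v' u u'

/-! ### Generic: no Frobenius-compact object without a non-torsion unit -/

namespace PreFrobenioidData

variable {C : Type u} [Category.{v} C] {D : Type u'} [Category.{v'} D]

/-- A unit-trivial object is not Frobenius-compact (Frobenius-compactness asks for a unit of infinite
order, [FrdI] Def. 1.2 (iv) "`O^×(A)^pf ≠ 0`"). [cite: MochizukiFrdI2008, Def. 1.2 (iv) p.23] -/
theorem not_isFrobeniusCompact_of_isUnitTrivial (S : PreFrobenioidData.{w} C D) {A : C}
    (hA : S.IsUnitTrivial A) : ¬ S.IsFrobeniusCompact A := by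
  rintro ⟨-, ⟨u, hu, hnt⟩, -⟩
  have h1 : u = 1 := by
    have h : S.unitsSubgroup A = ⊥ := hA
    rw [h] at hu
    exact Subgroup.mem_bot.mp hu
  exact hnt 1 one_pos (by rw [h1, one_pow])

/-- **Thm. 3.6 (ii), negative half, generic form**: if every object of `(C^un-tr)^birat` is unit-trivial
("`(A^un-tr)^birat` is of unit-trivial type", FrdII p. 38 l. 39), then `C` is not of rationally
standard type ([FrdI] Def. 4.5 (iii) (b) asks for a Frobenius-compact object of `(C^un-tr)^birat`).
[cite: MochizukiFrdII2008, Thm 3.6 (ii) p.37] -/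
theorem not_isOfRationallyStandardType_of_forall_isUnitTrivial (S : PreFrobenioidData.{w} C D)
    (R : S.RSParams) (hU : ∀ X : R.BU.Birat, R.BU.ops.IsUnitTrivial X) :
    ¬ S.IsOfRationallyStandardType R := fun h => by
  obtain ⟨X, hX⟩ := h.frobCompact
  exact R.BU.ops.not_isFrobeniusCompact_of_isUnitTrivial (hU X) hX

end PreFrobenioidData

namespace ArchFrd

variable {D : Type u} [Category.{v} D] (π : D ⥤ D0)

/-! ### (e) The divisor monoids `Φ = Φ₀|_D` and `0_D` are non-dilating -/

/-- **(e) for `C`**: `Φ = Φ₀|_D` (the constant monoid `ℝ_{≥0}` with identity transition maps) is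
non-dilating — every induced endomorphism of `Φ(X)` is the identity ("[since `Φ` is manifestly
non-dilating]", FrdII p. 38 l. 29). [cite: MochizukiFrdII2008, Thm 3.6 (i) p.36] -/
theorem C.isNonDilatingOn : (PreFrobenioidData.ofFunctor (Φ π) (C.toElem π)).IsNonDilatingOn := by
  refine ⟨fun X f _ a => ?_⟩
  induction a using Quotient.inductionOn with
  | h a => rfl

/-- **(e) for `A`**: the zero divisor monoid of the angular Frobenioid is non-dilating.
[cite: MochizukiFrdII2008, Thm 3.6 (ii) p.37] -/
theorem A.isNonDilatingOn :
    (PreFrobenioidData.ofFunctor (zeroMonoid D : Dᵒᵖ ⥤ CommMonCat.{0}) (A.toElem π)).IsNonDilatingOn :=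
  PreFrobenioidData.isNonDilatingOn_ofFunctor_zeroMonoid (A.toElem π)

/-! ### (c) Frobenius-normalized: `α^d ∘ φ = φ ∘ α` in `C = C₀ ×_{D₀} D` -/

/-- In `C = C₀ ×_{D₀} D`, an endomorphism lying over the identity of `D` has its `C₀`-component over the
identity of `D₀` (the compatibility square of the fiber product). [cite: MochizukiFrdII2008, Ex 3.3 (i) p.28] -/
theorem C.base_fst_eq_id_of_snd_eq_id {X : C π} (g : X ⟶ X) (hg : g.snd = 𝟙 X.snd) :
    C0.Base g.fst = 𝟙 _ := by
  have w := g.w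
  rw [hg, CategoryTheory.Functor.map_id, Category.comp_id] at w
  have h := congrArg (· ≫ X.iso.inv) w
  simp only [Category.assoc, Iso.hom_inv_id, Category.comp_id] at h
  exact h

/-- Membership in `O^▷(X)` of `C`, unpacked: the `D`-component is the identity, the `C₀`-component has
Frobenius degree `1` and lies over the identity of `D₀`. [cite: MochizukiFrdII2008, Ex 3.3 (i) p.28] -/
theorem C.endSubmonoid_components {X : C π} {α : End X}
    (hα : α ∈ (PreFrobenioidData.ofFunctor (Φ π) (C.toElem π)).endSubmonoid X) :
    CFP.Hom.snd α = 𝟙 X.snd ∧ C0.degFr (CFP.Hom.fst α) = 1 ∧ C0.Base (CFP.Hom.fst α) = 𝟙 _ :=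
  ⟨hα.1, hα.2, C.base_fst_eq_id_of_snd_eq_id π α hα.1⟩

/-- The scalar of the `n`-th power (in `End X`) of an element of `O^▷(X)` of `C` is the `n`-th power of
its scalar (no Galois twist intervenes: all bases are identities).
[cite: MochizukiFrdII2008, Ex 3.3 (i) p.28] -/
theorem C.scalar_fst_pow {X : C π} {α : End X}
    (hα : α ∈ (PreFrobenioidData.ofFunctor (Φ π) (C.toElem π)).endSubmonoid X) (n : ℕ) :
    C0.scalar (CFP.Hom.fst (α ^ n)) = C0.scalar (CFP.Hom.fst α) ^ n := by
  induction n with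
  | zero => rw [pow_zero, pow_zero]; rfl
  | succ n ih =>
    obtain ⟨-, hdeg, hbase⟩ := C.endSubmonoid_components π (Submonoid.pow_mem _ hα n)
    rw [pow_succ, End.mul_def, CFP.comp_fst, C0.scalar_comp', ih, hdeg, PNat.one_coe, pow_one,
      C.base_fst_eq_id_of_snd_eq_id π α hα.1]
    unfold D0.Hom.act
    rw [D0.twists_id, D0.galAct_false, pow_succ]

/-- **(c) for `C`**: `C` is of Frobenius-normalized type — for a base-identity endomorphism `φ` of degree
`d` and `α ∈ O^▷(X)`, `α^d ∘ φ = φ ∘ α` (both are `(id, d, c · a^d)` over the identity of `D`).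
[cite: MochizukiFrdII2008, Thm 3.6 (i) p.36] -/
theorem C.isOfFrobeniusNormalizedType :
    (PreFrobenioidData.ofFunctor (Φ π) (C.toElem π)).IsOfFrobeniusNormalizedType := by
  refine ⟨fun X φ hφ α hα => ?_⟩
  have hφsnd : CFP.Hom.snd φ = 𝟙 X.snd := hφ
  have hφbase : C0.Base (CFP.Hom.fst φ) = 𝟙 _ := C.base_fst_eq_id_of_snd_eq_id π φ hφsnd
  obtain ⟨hαsnd, hαdeg, hαbase⟩ := C.endSubmonoid_components π hα
  set d : ℕ+ := (PreFrobenioidData.ofFunctor (Φ π) (C.toElem π)).degFr φ with hd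
  have hdφ : C0.degFr (CFP.Hom.fst φ) = d := rfl
  obtain ⟨hαnsnd, hαndeg, hαnbase⟩ := C.endSubmonoid_components π (Submonoid.pow_mem _ hα (d : ℕ))
  rw [End.mul_def, End.mul_def]
  refine CFP.hom_ext ?_ ?_
  · rw [CFP.comp_fst, CFP.comp_fst]
    refine C0.hom_ext ?_ ?_ ?_
    · rw [C0.base_comp', C0.base_comp', hφbase, hαbase, hαnbase]
    · rw [C0.degFr_comp', C0.degFr_comp', hαdeg, hαndeg, one_mul, mul_one]
    · rw [C0.scalar_comp', C0.scalar_comp', hφbase, hαbase, hαndeg, hdφ, PNat.one_coe, pow_one,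
        C.scalar_fst_pow π hα]
      unfold D0.Hom.act
      rw [D0.twists_id, D0.galAct_false, D0.galAct_false, mul_comm]
  · rw [CFP.comp_snd, CFP.comp_snd, hφsnd, hαsnd, hαnsnd]

/-- Powers in `End X` of the wide subcategory `A ⊆ C` project to powers in `End X.obj` of `C`.
[cite: MochizukiFrdII2008, Ex 3.3 (iii) p.28] -/
theorem A.hom_pow {X : A π} (α : End X) (n : ℕ) :
    InducedWideCategory.Hom.hom (α ^ n) = End.of α.hom ^ n := by
  induction n with
  | zero => rfl
  | succ n ih =>
    rw [pow_succ, pow_succ, End.mul_def, End.mul_def]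
    change α.hom ≫ InducedWideCategory.Hom.hom (α ^ n) = α.hom ≫ End.of α.hom ^ n
    rw [ih]

/-- **(c) for `A`**: the angular Frobenioid is of Frobenius-normalized type ("follows immediately from
the corresponding property for `C` [together with the construction of `A`]", FrdII p. 38 l. 37: the
equation `α^d ∘ φ = φ ∘ α` is checked in `C`, powers being computed through the inclusion `A ⊆ C`).
[cite: MochizukiFrdII2008, Thm 3.6 (ii) p.37] -/
theorem A.isOfFrobeniusNormalizedType :
    (PreFrobenioidData.ofFunctor (zeroMonoid D : Dᵒᵖ ⥤ CommMonCat.{0})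
      (A.toElem π)).IsOfFrobeniusNormalizedType := by
  refine ⟨fun X φ hφ α hα => ?_⟩
  -- move to `C`: the equation is checked on the underlying arrows of `C`
  have hφ' : (PreFrobenioidData.ofFunctor (Φ π) (C.toElem π)).IsBaseIdentity (End.of φ.hom) := hφ
  have hα' : End.of α.hom ∈ (PreFrobenioidData.ofFunctor (Φ π) (C.toElem π)).endSubmonoid X.obj :=
    ⟨hα.1, hα.2⟩
  have key := (C.isOfFrobeniusNormalizedType π).obj X.obj (End.of φ.hom) hφ' (End.of α.hom) hα'
  set d : ℕ+ := (PreFrobenioidData.ofFunctor (zeroMonoid D : Dᵒᵖ ⥤ CommMonCat.{0})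
    (A.toElem π)).degFr φ with hd
  have h' : End.of (InducedWideCategory.Hom.hom (α ^ (d : ℕ) * φ)) =
      End.of (InducedWideCategory.Hom.hom (φ * α)) :=
    calc End.of (InducedWideCategory.Hom.hom (α ^ (d : ℕ) * φ))
        = End.of (InducedWideCategory.Hom.hom (α ^ (d : ℕ))) * End.of φ.hom := rfl
      _ = End.of α.hom ^ (d : ℕ) * End.of φ.hom := by rw [A.hom_pow]
      _ = End.of φ.hom * End.of α.hom := key
      _ = End.of (InducedWideCategory.Hom.hom (φ * α)) := rfl
  exact WideSubcategory.hom_ext _ h'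

/-! ### (a) Frobenius-isotropic -/

/-- **(a) for `C`**, Frobenius-isotropic type, read through the adapter (Ex. 3.3 (ii), PROVED in
`ArchimedeanFrobeniusIsotropic.lean`). [cite: MochizukiFrdII2008, Thm 3.6 (i) p.36] -/
theorem C.isOfFrobeniusIsotropicType :
    (PreFrobenioidData.ofFunctor (Φ π) (C.toElem π)).IsOfFrobeniusIsotropicType := by
  refine ⟨fun X => ?_⟩
  obtain ⟨B, φ, hφ, hB⟩ := Ex33ii_frobeniusIsotropic_holds π X
  exact ⟨B, φ, (PreFrobenioidData.ofFunctor_isFrobeniusType _ φ).mpr hφ,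
    (PreFrobenioidData.ofFunctor_isIsotropic _ B).mpr hB⟩

/-- **(a) for `A`**, Frobenius-isotropic type ("follows immediately from the corresponding property for
`C` [together with the construction of `A`]", FrdII p. 38 l. 37): the Frobenius-type arrow `X → B` of `C`
with isotropic codomain is an isometry, hence an arrow of `A`; it is co-angular in `A` iff in `C`
(Ex. 3.3 (iii)), a base-isomorphism on the nose, and `B` is isotropic in `A` iff in `C` (Ex. 3.3 (iii)).
[cite: MochizukiFrdII2008, Thm 3.6 (ii) p.37] -/
theorem A.isOfFrobeniusIsotropicType :
    (PreFrobenioidData.ofFunctor (zeroMonoid D : Dᵒᵖ ⥤ CommMonCat.{0})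
      (A.toElem π)).IsOfFrobeniusIsotropicType := by
  refine ⟨fun X => ?_⟩
  obtain ⟨B, φ, ⟨⟨hco, hiso⟩, hbi⟩, hB⟩ := Ex33ii_frobeniusIsotropic_holds π X.obj
  let B' : A π := ⟨B⟩
  let φ' : X ⟶ B' := ⟨φ, hiso⟩
  refine ⟨B', φ', (PreFrobenioidData.ofFunctor_isFrobeniusType _ φ').mpr ⟨⟨?_, ?_⟩, hbi⟩,
    (PreFrobenioidData.ofFunctor_isIsotropic _ B').mpr ((Ex33iii_isotropic_iff_holds π B').mpr hB)⟩
  · exact (Ex33iii_coAngular_iff_holds π φ').mpr hco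
  · exact Subsingleton.elim _ _

/-! ### (b) `C` is not of group-like type -/

/-- **(b) for `C`** is vacuous: `C` is NOT of group-like type as soon as `D` has an object
(`Φ(X) = ℝ_{≥0} ∋ 2 ≠ 1`; Thm. 3.6 (i) "but not of group-like type").
[cite: MochizukiFrdII2008, Thm 3.6 (i) p.36] -/
theorem C.not_isOfGroupLikeType (X : C π) :
    ¬ (PreFrobenioidData.ofFunctor (Φ π) (C.toElem π)).IsOfGroupLikeType := by
  intro h
  have h2 := h.obj X (Multiplicative.ofAdd (2 : NNReal))
  have h3 := h.obj X (Multiplicative.ofAdd (3 : NNReal))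
  have e : (Multiplicative.ofAdd (2 : NNReal) : Multiplicative NNReal) = Multiplicative.ofAdd 3 :=
    h2.trans h3.symm
  have e' : (2 : NNReal) = 3 := Multiplicative.ofAdd.injective e
  norm_num at e'

/-! ### The assemblies: standard type modulo the named inputs -/

/-- **Thm. 3.6 (ii), "`A` is of standard type" — ASSEMBLY modulo its two outstanding inputs**: over a
base `D` of FSMFF- and RC-iso-subanchor type, GIVEN Prop. 3.5 (ii) for `A` (`ArchFrd.Prop35ii_A π`,
node `FrdII:Prop3.5(ii)`: quasi-isotropic) and ONE isotropic Frobenius-compact object of `A` (print: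
"[`D` admits complex objects] … the complex isotropic objects of `A` are Frobenius-compact"), the angular
Frobenioid `A` is of standard type: the remaining fields (Frobenius-isotropic, Frobenius-normalized,
non-dilating; group-like case (b) fed by the given object) are PROVED above.
[cite: MochizukiFrdII2008, Thm 3.6 (ii) p.37] -/
theorem A.isOfStandardType_of (hD : IsOfFSMFFType D) (hrc : RC.IsOfRCIsoSubanchorType (baseRC π))
    (h35 : Prop35ii_A π)
    (hfc : ∃ X : A π,
      (PreFrobenioidData.ofFunctor (zeroMonoid D : Dᵒᵖ ⥤ CommMonCat.{0}) (A.toElem π)).IsIsotropic X ∧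
        (PreFrobenioidData.ofFunctor (zeroMonoid D : Dᵒᵖ ⥤ CommMonCat.{0})
          (A.toElem π)).IsFrobeniusCompact X) :
    (PreFrobenioidData.ofFunctor (zeroMonoid D : Dᵒᵖ ⥤ CommMonCat.{0}) (A.toElem π)).IsOfStandardType where
  quasiIsotropic := ⟨fun X => by
    rw [PreFrobenioidData.ofFunctor_isIsotropic]
    exact h35 hrc X⟩
  frobeniusIsotropic := A.isOfFrobeniusIsotropicType π
  frobeniusCompact_of_groupLike _ := hfc
  frobeniusNormalized := A.isOfFrobeniusNormalizedType π
  fsmff := hD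
  nonDilating := A.isNonDilatingOn π

/-- **Thm. 3.6 (i), the "standard type" part of "`C` is of rationally standard type" (`Λ = ℤ`) —
ASSEMBLY modulo Prop. 3.5 (ii) for `C`** (`ArchFrd.Prop35ii_C π`), over a base `D` of FSMFF- and
RC-iso-subanchor type having an object (clause (b) is then vacuous, `C.not_isOfGroupLikeType`).
[cite: MochizukiFrdII2008, Thm 3.6 (i) p.36] -/
theorem C.isOfStandardType_of (hD : IsOfFSMFFType D) (hrc : RC.IsOfRCIsoSubanchorType (baseRC π))
    (h35 : Prop35ii_C π) (X₀ : C π) :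
    (PreFrobenioidData.ofFunctor (Φ π) (C.toElem π)).IsOfStandardType where
  quasiIsotropic := ⟨fun X => by
    rw [PreFrobenioidData.ofFunctor_isIsotropic]
    exact h35 hrc X⟩
  frobeniusIsotropic := C.isOfFrobeniusIsotropicType π
  frobeniusCompact_of_groupLike h := (C.not_isOfGroupLikeType π X₀ h).elim
  frobeniusNormalized := C.isOfFrobeniusNormalizedType π
  fsmff := hD
  nonDilating := C.isNonDilatingOn π

end ArchFrd

end Literature.AlgebraicGeometry.Frobenioids
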